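import Summits.QuantumFields.Balaban3D.Proofs.NegativeEdge

/-!
# Bałaban CMP 102 (1985), d = 3 lane — `Proofs.ConcreteWitness`: the concrete leaf bundle `ConcreteLeaves` is INHABITED over
# every lattice approximation `S : Scales L` and every constant profile (non-vacuity of the end theorem's hypotheses), and
# the two readings of Theorem 1 SEPARATE on it

Source: T. Bałaban, *Ultraviolet stability of three-dimensional lattice pure gauge field theories*, Commun. Math. Phys. **102**
(1985) 255–275 [Balaban1985UV3] ([B10]).  Lane `pub-balaban3d`, seat p3.

WHY.  The end theorem `UVStability3D.uvStability3D_compact(_eps0)` takes the analytic leaves of Sects. A/C/D as the hypothesis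
bundle `ConcreteLeaves C S T` tied to the spine's CONCRETE numbers (g_k, |T₁^{(k)}|, the star count of p. 260 on the torus of
`Setup`, the remainder unit (g_k²)^{3+κ₀}|T₁^{(k)}|, E^{(k)} by (62), E_k by (64)).  As the 4D cell did for its abstract bundle
(`B10Assembly.trivLeafSystem`, `B10DagLeaf.logRun`), this file checks that the CONCRETE bundle is jointly satisfiable — for EVERY
`S : Scales L`, EVERY `FamilyConsts`/`StepConsts` profile — by the "log run": one configuration and one history per scale, no
interaction, no large fields, all cluster-expansion outputs zero, `E^{(k)} = (log σ₀ + d(𝔤) log g_k)|T₁^{(k)*}|` with the concrete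
star count, `E_k = Σ_{j≥k} E^{(j)}` (64), `ρ_k ≡ e^{−E_k}`, the remainder booked as `rstar·Σ_{j<k}(g_j²)^{3+κ₀}|T₁^{(j)}|`.  So the
equations of `ConcreteLeaves` contain no contradiction and the end theorem is not vacuous; and with `d(𝔤) ≥ 1` the literal
reading of Theorem 1 FAILS on this concrete family while the compact reading holds (`witness_separation`) — the lane's negative
edge G-B10-01 realised on the spine's own numbers.  A statement about the TYPING, not about Yang–Mills.
-/

namespace Summit.QuantumFields.Balaban3D.Proofs.ConcreteWitness

open Literature.MathematicalPhysics.QuantumFieldTheory.Balaban1983to89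
open Literature.MathematicalPhysics.QuantumFieldTheory.Balaban1983to89.B10
open Literature.MathematicalPhysics.QuantumFieldTheory.Balaban1983to89.B10SectAGathering
open Literature.MathematicalPhysics.QuantumFieldTheory.Balaban1985CMP102.Setting
open Summit.QuantumFields.Balaban3D.Proofs.ScalesArithmetic
open Summit.QuantumFields.Balaban3D.Proofs.Constants
open Summit.QuantumFields.Balaban3D.Proofs.UVStability3D
open Summit.QuantumFields.Balaban3D.Proofs.NegativeEdge

variable {L : ℕ} (F : FamilyConsts L) (sc : StepConsts) (S : Scales L)

/-! ## §1 The numbers of the log run -/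

/-- `|T₁^{(k)*}|` := the concrete star count of p. 260 on the torus of `S` (coarse level `k + 1`). [cite: Balaban1985UV3, (18) p.260] -/
noncomputable def wStarT (S : Scales L) (k : ℕ) : ℝ :=
  (B10StarCount.starCount (Finset.univ : Finset (Site S.P (k + 1))) : ℝ)

/-- The remainder unit `(g_k²)^{3+κ₀}|T₁^{(k)}|` (R-NORM). [cite: Balaban1985UV3, p.269] -/
noncomputable def wRem (S : Scales L) (k : ℕ) : ℝ := (S.gk k ^ 2) ^ (3 + F.κ₀) * S.sites k

/-- The booked remainder `Rm k = rstar·Σ_{j<k}(g_j²)^{3+κ₀}|T₁^{(j)}|` of (41). [cite: Balaban1985UV3, (41) p.266] -/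
noncomputable def wRm (S : Scales L) (k : ℕ) : ℝ := sc.rstar * ∑ j ∈ Finset.range k, wRem F S j

/-- `E^{(k)} = (log σ₀ + d(𝔤) log g_k)|T₁^{(k)*}|` — (62) p. 271 with `log Z^{(k)}(T,1) = Σ_X𝒫′ = 0`. [cite: Balaban1985UV3, (62) p.271] -/
noncomputable def wEstep (S : Scales L) (k : ℕ) : ℝ := (F.logσ₀ + (F.dimg : ℝ) * Real.log (S.gk k)) * wStarT S k

/-- `E_k = Σ_{j=k}^{K−1} E^{(j)}` — (64) p. 273 (`B10.Ek`). [cite: Balaban1985UV3, (64) p.273] -/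
noncomputable def wEcst (S : Scales L) (k : ℕ) : ℝ := Ek (wEstep F S) S.K k

/-- `rem ≥ 0`. [folklore] -/
theorem wRem_nonneg (k : ℕ) : 0 ≤ wRem F S k :=
  mul_nonneg (Real.rpow_nonneg (sq_nonneg _) _) (sites_nonneg S k)

/-- `Rm k ≥ 0`. [folklore] -/
theorem wRm_nonneg (k : ℕ) : 0 ≤ wRm F sc S k :=
  mul_nonneg sc.rstar_nonneg (Finset.sum_nonneg fun j _ => wRem_nonneg F S j)

/-- `Rm 0 = 0` (empty sum). [folklore] -/
theorem wRm_zero : wRm F sc S 0 = 0 := by simp [wRm]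

/-- `Rm (k+1) = Rm k + rstar·rem_k`. [folklore] -/
theorem wRm_succ (k : ℕ) : wRm F sc S (k + 1) = wRm F sc S k + sc.rstar * wRem F S k := by
  simp [wRm, Finset.sum_range_succ, mul_add]

/-- `E_{k+1} = E_k − E^{(k)}` for `k < K` (`B10.Ek_succ`). [cite: Balaban1985UV3, (62) p.271] -/
theorem wEcst_succ {k : ℕ} (hk : k < S.K) : wEcst F S (k + 1) = wEcst F S k - wEstep F S k := by
  unfold wEcst
  exact Ek_succ (wEstep F S) hk

/-! ## §2 The log run as a tower carrier, its step pieces and leaves -/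

/-- THE LOG RUN over `S` (one configuration, one history per scale; `ρ_k ≡ e^{−E_k}`, `χ ≡ 1`, action/interaction/Z-terms 0,
`LF_k(U, Φ) = exp Φ(·)`; `g_k`, `|T₁^{(k)}|`, `K` the spine's; `M₁, b₀, p₀` the family's; `Rm` booked). [folklore] -/
noncomputable def wTower : TowerRun where
  K := S.K
  Cfg := fun _ => Unit
  ρ := fun k _ => Real.exp (-(wEcst F S k))
  χ := fun _ _ => 1
  wilsonBG := fun _ _ => 0
  sites := S.sites
  g := S.gk
  Ineq41_47 := fun _ => True
  Hist := fun _ => Unit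
  triv := fun _ => ()
  LF := fun _ _ Φ => Real.exp (Φ ())
  lf_mono := fun _ _ Φ Ψ h => Real.exp_le_exp.mpr (h ())
  lf_shift := fun _ _ Φ t => by
    show Real.exp (Φ () + t) = Real.exp t * Real.exp (Φ ())
    rw [Real.exp_add, mul_comm]
  mainT := fun _ _ _ => 0
  mainT_triv := fun _ _ => by simp
  Pint := fun _ _ _ => 0
  Λvol := fun _ _ => 0
  Λvol_le := fun k _ => sites_nonneg S k
  Zterm := fun _ _ => 0
  Zterm_triv := fun _ => rfl
  Ecst := wEcst F S
  Estep := wEstep F S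
  Ecst_eq := fun _ => rfl
  Rm := wRm F sc S
  χ_nonneg := fun _ _ => zero_le_one
  sites_nonneg := sites_nonneg S
  M₁ := F.M₁
  b₀ := F.b₀
  p₀ := F.p₀

/-- (41)_k and (47)_k hold for the log run at every k (`Rm k ≥ 0`). [folklore] -/
theorem wTower_ineqs (k : ℕ) : Ineq41 (wTower F sc S) k ∧ Ineq47 (wTower F sc S) k := by
  constructor
  · intro U
    show Real.exp (-(wEcst F S k)) ≤ Real.exp (-(0 : ℝ) + 0 - wEcst F S k + 0 + wRm F sc S k)
    exact Real.exp_le_exp.mpr (by linarith [wRm_nonneg F sc S k])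
  · intro U
    show (1 : ℝ) * Real.exp (-(0 : ℝ) + 0 - wEcst F S k - wRm F sc S k) ≤ Real.exp (-(wEcst F S k))
    rw [one_mul]
    exact Real.exp_le_exp.mpr (by linarith [wRm_nonneg F sc S k])

/-- The step pieces of the log run: the CONCRETE star count (both `starT` and `starB`), the family's `log σ₀`, `d(𝔤)`, the
normalised remainder unit; every cluster-expansion output 0; |Z_k| = 0. [folklore] -/
noncomputable def wPieces (k : ℕ) : StepPieces (wTower F sc S) k where
  proj := fun _ => ()
  proj_triv := rfl
  Zvol := fun _ => 0
  Zvol_nonneg := fun _ => le_rfl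
  Zvol_triv := rfl
  starB := fun _ => wStarT S k
  starT := wStarT S k
  logσ₀ := F.logσ₀
  dg := F.dimg
  dg_nonneg := Nat.cast_nonneg _
  logZU := fun _ _ => 0
  logZ1 := fun _ => 0
  logZT := 0
  logFl := fun _ _ => 0
  PprU := fun _ _ => 0
  Ppr1 := fun _ => 0
  PprT := 0
  PY := fun _ _ => 0
  PYZ := fun _ _ => 0
  Pold := fun _ _ => 0
  PoldIn := fun _ _ => 0
  rem := wRem F S k
  rem_nonneg := wRem_nonneg F S k

/-- The fourteen step leaves hold for the log run with all ten step constants 0, at every `k < K`. [folklore] -/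
noncomputable def wLeaves (k : ℕ) (hk : k + 1 ≤ S.K) : StepLeaves (wTower F sc S) k where
  P := wPieces F sc S k
  Cz := 0
  C₁ := 0
  C₁' := 0
  C₂ := 0
  Cv := 0
  C₃ := 0
  C₄ := 0
  C₅ := 0
  c₁ := 0
  C₆ := 0
  bound55 := by
    intro _ U
    show Real.exp (-(wEcst F S (k + 1))) ≤ Real.exp (-(0 : ℝ) - wEcst F S k
      + (F.logσ₀ + (F.dimg : ℝ) * Real.log (S.gk k)) * wStarT S k + 0 + 0 + 0 + wRm F sc S k + 0)
    rw [wEcst_succ F S (by omega)]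
    apply Real.exp_le_exp.mpr
    unfold wEstep
    linarith [wRm_nonneg F sc S k]
  bound55Lower := by
    intro _ U
    show (1 : ℝ) * Real.exp (-(0 : ℝ) - wEcst F S k
      + (F.logσ₀ + (F.dimg : ℝ) * Real.log (S.gk k)) * wStarT S k + 0 + 0 - wRm F sc S k + 0)
      ≤ Real.exp (-(wEcst F S (k + 1)))
    rw [one_mul, wEcst_succ F S (by omega)]
    apply Real.exp_le_exp.mpr
    unfold wEstep
    linarith [wRm_nonneg F sc S k]
  cumulant58 := fun _ _ => by
    show (0 : ℝ) ≤ 0 + 0 * S.gk k * 0 + 0 * wRem F S k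
    simp
  cumulantLower := fun _ => by
    show (0 : ℝ) - 0 * wRem F S k ≤ 0
    simp
  repr33_60 := fun _ _ => by
    show |(0 : ℝ) - (0 + 0)| ≤ 0 * wRem F S k
    simp
  vacuumWhole := fun _ => by
    show |(0 : ℝ) - 0| ≤ 0 * S.gk k * 0 + 0 * wRem F S k
    simp
  decomp35_61 := fun _ _ => by
    show |(0 : ℝ) - 0 - 0| ≤ 0 * wRem F S k
    simp
  norm35 := fun _ => by
    show |(0 : ℝ) - 0| ≤ 0 * 0
    simp
  starCount := fun _ => by
    show 0 ≤ wStarT S k - wStarT S k ∧ wStarT S k - wStarT S k ≤ 0 * 0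
    simp
  oldOutside := fun _ _ => by
    show |(0 : ℝ) - 0| ≤ 0 * 0
    simp
  pintSucc := fun _ _ => by
    show (0 : ℝ) = 0 + 0 + 0
    simp
  estep62 := by
    show wEstep F S k = (F.logσ₀ + (F.dimg : ℝ) * Real.log (S.gk k)) * wStarT S k + 0 + 0
    simp [wEstep]
  ztermSucc := fun _ => by
    show (0 : ℝ) + _ * 0 ≤ 0
    simp
  rmSucc := by
    show wRm F sc S k + (max 0 0 + 0 + 0 + 0) * wRem F S k ≤ wRm F sc S (k + 1)
    rw [wRm_succ, max_self]
    have := mul_nonneg sc.rstar_nonneg (wRem_nonneg F S k)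
    linarith

/-! ## §3 The concrete leaf bundle is inhabited; the end theorem and the negative edge apply to the witness -/

/-- **`ConcreteLeaves (consts3 F sc) S (wTower F sc S)` IS INHABITED** — for every lattice approximation `S`, every family profile
`F` and step profile `sc`: every concreteness equation holds by `rfl`, every analytic leaf with constants 0.  Hence the hypothesis
bundle of the end theorem is jointly satisfiable on the spine's concrete numbers (non-vacuity). [folklore] -/
noncomputable def wConcreteLeaves : ConcreteLeaves (consts3 F sc) S (wTower F sc S) where
  K_eq := rfl
  g_eq := fun _ => rfl
  sites_eq := fun _ => rfl
  par := ⟨rfl, rfl, rfl⟩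
  Rm_eq := fun _ => rfl
  Λvol_nonneg := fun _ _ => le_rfl
  spec := fun k => ⟨fun _ => wTower_ineqs F sc S k, fun _ => trivial⟩
  step0 := wTower_ineqs F sc S 0
  noInt0 := fun _ _ => rfl
  steps := fun k hk => wLeaves F sc S k hk
  bound46 := fun k _ _ h U => by
    show |(0 : ℝ)| ≤ F.C46 * F.M₁ ^ 3 * (S.gk (k - 1) ^ 2 * pFun F.b₀ F.p₀ (S.gk (k - 1)) ^ 2) * 0
    simp
  logZT_le := fun k _ => by
    show |(0 : ℝ)| ≤ F.z * S.sites k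
    rw [abs_zero]
    exact mul_nonneg F.z_nonneg (sites_nonneg S k)
  PprT_le := fun k _ => by
    show |(0 : ℝ)| ≤ F.aP * S.sites k
    rw [abs_zero]
    exact mul_nonneg F.aP_nonneg (sites_nonneg S k)
  lf := fun k _ U => by
    show Real.exp (-(0 : ℝ) + 0) ≤ Real.exp (6 / Real.log L * S.sites k)
    apply Real.exp_le_exp.mpr
    have h : 0 ≤ 6 / Real.log L * S.sites k := mul_nonneg (consts3 F sc).d_nonneg (sites_nonneg S k)
    simpa using h
  starT_eq := fun _ _ => rfl
  logσ₀_le := fun _ _ => le_rfl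
  dg_le := fun _ _ => le_rfl
  rem_eq := fun _ _ => rfl

/-- The concrete bundle is inhabited (for every `S`, `F`, `sc`). [folklore] -/
theorem concreteLeaves_nonempty : Nonempty (ConcreteLeaves (consts3 F sc) S (wTower F sc S)) :=
  ⟨wConcreteLeaves F sc S⟩

/-- The end theorem applied to the witness family of ALL lattice approximations: `B10.Thm1PrintedCompact ∧ B10.Thm2Printed` for
`fun S : Scales L => (wTower F sc S).toRunData`. (Consistency of the typing, nothing about gauge theory.) [folklore] -/
theorem witness_thm1Compact_and_thm2 :
    Thm1PrintedCompact (fun S : Scales L => (wTower F sc S).toRunData)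
      ∧ Thm2Printed (fun S : Scales L => (wTower F sc S).toRunData) :=
  uvStability3D_compact_family (consts3 F sc) (normalisedConsts_consts3 F sc) _ (fun S => S) (fun S => wTower F sc S)
    (fun _ => rfl) (fun S => wConcreteLeaves F sc S)

/-- **THE TWO READINGS SEPARATE ON THE CONCRETE NUMBERS**: for `d(𝔤) ≥ 1` (any non-discrete group) and any block size `L` (odd,
`> 1`), the witness family over ALL lattice approximations satisfies `B10.Thm1PrintedCompact ∧ B10.Thm2Printed` and
`¬ B10.Thm1Printed` — the negative edge G-B10-01 realised with the spine's `g_k`, `|T₁^{(k)}|` and the torus star count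
`|T₁^{(k)*}| = 2(1 − L⁻³)|T₁^{(k)}|` of `Setup` ((62) p. 271: `−E ∋ d(𝔤)|T₁^{(j)*}| log g_j⁻¹`). [cite: Balaban1985UV3, Thm 1 p.257 + (62) p.271] -/
theorem witness_separation (hL : Odd L ∧ 1 < L) (hdim : 1 ≤ F.dimg) :
    (Thm1PrintedCompact (fun S : Scales L => (wTower F sc S).toRunData)
      ∧ Thm2Printed (fun S : Scales L => (wTower F sc S).toRunData))
    ∧ ¬ Thm1Printed (fun S : Scales L => (wTower F sc S).toRunData) := by
  refine ⟨witness_thm1Compact_and_thm2 F sc, ?_⟩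
  exact not_thm1Printed_concrete (consts3 F sc) (normalisedConsts_consts3 F sc) _ (fun S => S) (fun S => wTower F sc S)
    (fun _ => rfl) (fun S => wConcreteLeaves F sc S) one_pos
    (fun S k hk => by
      show (1 : ℝ) ≤ (F.dimg : ℝ)
      exact_mod_cast hdim)
    (fun S => ⟨(), rfl, rfl⟩) (scales_fine hL)

end Summit.QuantumFields.Balaban3D.Proofs.ConcreteWitness
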